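/-
Copyright (c) 2026 the pub-hodgecm-mathlib formalisation cell (harness21).  Prover seat hodgecm-mathlib-F0P2-p09 (g0), re-dealt to L1
`stub_firstTermThetaPairing` (director s1969∕s1970); hLiu418 = `stmt-HodgeConjecture-24832`; I4-conv (F′-fact), the `hlaw` PAYER of FILE C (hypothesis-first core).
-/
import Summits.HodgeConjecture.HodgeConjecture.Theorems.K2LiuKlingenInnerSectionLocalDefs    -- ★ B (p861422): `skewLoc`, `jLoc`, `nKlingenLoc`, `klingenLeviLoc`, `weylXiLoc`, `innerSectionLoc`
import Summits.HodgeConjecture.HodgeConjecture.Theorems.K2LiuKlingenInnerSectionLeviLaw      -- ★ F5-c §0 (ring-generic): `nKlingen_mul_klingenLevi_of_upper`, `nKlingen_eq_uPlus_mul`, `skew_yPrime`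
import Summits.HodgeConjecture.HodgeConjecture.Theorems.K2LiuKlingenCellOneEisensteinU        -- ★ `klingenLevi_one_mul`
import Literature.NumberTheory.Automorphic.AdelicSecondCountable                             -- ★ `secondCountableTopology_adicCompletion`
import Mathlib.MeasureTheory.Group.Prod
import Mathlib.MeasureTheory.Measure.WithDensity
import HarnessLib

/-!
# Crux `HLiu418`, I4-conv (F′-fact) — `K2LiuKlingenInnerSectionLocalLaw`: THE LOCAL BOREL LAW OF THE INNER FUNCTIONAL OF THE KLINGEN FIBRE
# `J_v(b g) = c_Δ(b) · m_T(b₀₀) · J_v(g)` for upper-triangular `b ∈ U(J₂)(L⁺_v)` — FILE C's binder `hlaw`, hypothesis-first (local twin of ★ F5-c ∕ F5-n ∕ F8)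

Cell `hodgecm-mathlib`, crux item hLiu418 = `stmt-HodgeConjecture-24832`; squad K2 ∕ K2Liu (re-dealt hand F0P2-p09 (g0)); LEAD F0P6-plan (g14); desk K2Liu-p14 (g3) («THE ONE UNPAID
LETTER OF THE ORGAN = C's `hlaw`», 15:48:53Z).  THEOREMS ONLY (no `def`, no instance, no notation, no named-fact hypothesis, no `sorry`); lane `--supports stmt-HodgeConjecture-24832 --as helper`.

THE POINT.  ★ C `K2LiuKlingenInnerSectionSpherical` proves `J_v = J_v(1)·Λ^{line}_{σ,v}∘Ψ_{S,v}` at a good place FROM the local Borel law `hlaw` of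
`J_v := innerSectionLoc v ν_Y ν_T Ψ_v f_v x_v` (★ B: `J_v(y) = ∫_{Y_v × L_v} f_v(Ψ_v(ξ·n_Q(q₁,0,q₂)·m_Q(1,y))·x_v) d(ν_Y ⊗ ν_T)(q)`) and right-`K`-invariance `hK`.  This file PAYS `hlaw` in the same
hypothesis-first currency: for UPPER-TRIANGULAR `b ∈ U(J₂)(L⁺_v)` (`(b_w)₁₀ = 0`, `u_w = (b_w)₀₀`),
  `J_v(b·g) = c_Δ(b) · m_T(u) · J_v(g)`,
GIVEN (by value, discharged downstream for `f_v := Λ_v`, `Ψ_v := psiLoc Ψ v`, `ν_T` Haar): (`hfP`) the left law of `f_v` under the Siegel-parabolic element `Ψ_v(ξ m_Q(1,b) ξ⁻¹)`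
with multiplier `c_Δ(b)` (for `Λ_v`: ★ `lambdaLoc_siegel_mul`, value `χ_v(u)|u|_v^{s+1}`), (`hfU`) invariance of `f_v` under the Siegel-unipotent `Ψ_v(ξ u₊(z) ξ⁻¹)`, (`hνT`) the scaling law
`ν_T ∘ (·u)⁻¹ = m_T(u)·ν_T` (Haar: `m_T(u) = |u|_v⁻¹`), and left-invariance of `ν_Y`.  PROOF = the ring-generic algebra of ★ F5-c §0 at `R := L_v = Π_{w∣v} L_w` —
`n_Q(y,0,t)·m_Q(1,b) = m_Q(1,b)·u₊(z′)·n_Q(y′,0,t′)`, `t′ = t u`, `z′ = t b₀₁`, `y′ = y + z′ σ(t′)` (★ `nKlingen_mul_klingenLevi_of_upper`, ★ `nKlingen_eq_uPlus_mul`, ★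
`klingenLevi_one_mul`), transported through ★ B's `jLoc` — followed by TWO SUBSTITUTIONS on `Y_v × L_v`: the shear `(y,t) ↦ (y + λ_b(t), t)` preserves `ν_Y ⊗ ν_T` (Mathlib
`MeasurePreserving.skew_product`; no integrability needed) and the scaling `t ↦ t u` multiplies it by `m_T(u)` (`hνT`, `Measure.map_prod_map`).
* §1 (ring-generic, `R`, `σ` involutive): `skewShift_skew`, `add_skewShift_skew` (`λ_b(t) = t b₀₁ σ(t b₀₀)` and `y + λ_b(t)` are skew), **`weylXi_nKlingen_klingenLevi_of_upper`**
  (the letter identity `ξ·n_Q(y,0,t)·m_Q(1,bg) = (ξ m_Q(1,b) ξ⁻¹)·((ξ u₊(t b₀₁) ξ⁻¹)·(ξ·n_Q(y + λ_b(t),0,t b₀₀)·m_Q(1,g)))`);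
* §2 **`innerSectionLoc_upper_mul`** — THE PAYER at `v` (shear = Mathlib `MeasurePreserving.skew_product` after a swap; scaling = `Measure.map_prod_map` + `hνT` +
  `Measure.prod_smul_right`; both as measurable equivalences, so no integrability hypothesis: `MeasurePreserving.integral_comp'`, `integral_map_equiv`).
[MoeglinWaldspurger1995, II.1.7], [Casselman1980, §3], [Xiong2013, §7 L. 7.1], [Tan1999, §2], [BorelJacquet1979, §4.1].
HONEST LABEL.  Count-neutral helper: `HC_CM` is proved only modulo the 7 printed citations (2 remaining named inputs: hLiu418 = `stmt-HodgeConjecture-24832`,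
h413 = `stmt-HodgeConjecture-24833`) until rung 0 closes; this file closes no socket by itself.

## Mathlib ∕ tree search
Tree ★: B `K2LiuKlingenInnerSectionLocalDefs.{skewLoc, mem_skewLoc_iff, jLoc, coe_jLoc_symm_apply, nKlingenLoc, klingenLeviLoc, weylXiLoc, innerSectionLoc}`, F5-c §0 (ring-generic)
`K2LiuKlingenInnerSectionLeviLaw.{nKlingen_mul_klingenLevi_of_upper, nKlingen_eq_uPlus_mul, skew_yPrime, nKlingen_congr, upper_rel₃}`, `K2LiuKlingenCellOneEisensteinU.klingenLevi_one_mul`,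
`UnitaryGroupBorelInduction.conjLocal_conjLocal_cm`.  Mathlib: `MeasurePreserving.skew_product`, `measurePreserving_swap`, `Measure.map_prod_map`, `Measure.prod_smul_right`,
`integral_map_equiv`, `integral_smul_measure`, `MeasurePreserving.integral_comp'`.  Dedup: `rg "innerSectionLoc_upper|LocalLaw" Summits/` — none.

## References
* [MoeglinWaldspurger1995] C. Mœglin, J.-L. Waldspurger, *Spectral decomposition and Eisenstein series* (1995), II.1.7.
* [Casselman1980] W. Casselman, *The unramified principal series of p-adic groups I*, Compositio Math. 40 (1980), §3.
* [Xiong2013] W. Xiong, arXiv:1302.4222 (2013), §7 Lemma 7.1.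
* [BorelJacquet1979] A. Borel, H. Jacquet, PSPM 33.1 (1979), §4.1.
-/

set_option autoImplicit false
set_option linter.dupNamespace false -- the mandated namespace repeats `HodgeConjecture.HodgeConjecture`

noncomputable section

open scoped Matrix ENNReal NNReal
open NumberField IsDedekindDomain MeasureTheory Measure Filter Set

namespace Summit.HodgeConjecture.HodgeConjecture.Cruxes.HLiu418.K2LiuKlingenInnerSectionLocalLaw

open Literature.NumberTheory.Automorphic Literature.NumberTheory.Automorphic.UnitaryGroup
open Literature.NumberTheory.GelbartRogawski1991 Literature.NumberTheory.GelbartRogawski1991.GRConstruction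
open Summit.HodgeConjecture.HodgeConjecture.Cruxes.HLiu418.K2LiuDoubledUTwoTwoBorelFrame
open Summit.HodgeConjecture.HodgeConjecture.Cruxes.HLiu418.K2LiuKlingenParabolicDefs
open Summit.HodgeConjecture.HodgeConjecture.Cruxes.HLiu418.K2LiuKlingenInnerSectionLeviLaw
open Summit.HodgeConjecture.HodgeConjecture.Cruxes.HLiu418.K2LiuKlingenCellOneEisensteinU (klingenLevi_one_mul)
open Summit.HodgeConjecture.HodgeConjecture.Cruxes.HLiu418.K2LiuKlingenInnerSectionLocalDefs

variable (L : Type) [Field L] [NumberField L] [IsCMField L] (v : HeightOneSpectrum (𝓞 (Fp L)))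

/-! ## §1 The letter identity (ring-generic): `ξ · n_Q(y,0,t) · m_Q(1, b g) = (ξ m_Q(1,b) ξ⁻¹) · (ξ u₊(z′) ξ⁻¹) · (ξ · n_Q(y′,0,t′) · m_Q(1,g))` -/

section Generic

variable {R : Type*} [CommRing R] {σ : R →+* R}

/-- the shift `λ_b(t) = t·b₀₁·σ(t·b₀₀)` is skew for upper-triangular `b ∈ U(J₂)` (★ `skew_yPrime` at `a = 1`, `y = 0`). [cite: Xiong2013, §7 Lemma 7.1] -/
theorem skewShift_skew (hσ : ∀ x, σ (σ x) = x) {b : unitaryGroupOfForm σ ((StdForm.antidiagonal 2).over R)} (hb : ((b : GL (Fin 2) R) : Matrix (Fin 2) (Fin 2) R) 1 0 = 0) (t : R) :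
    σ (t * ((b : GL (Fin 2) R) : Matrix (Fin 2) (Fin 2) R) 0 1 * σ (t * ((b : GL (Fin 2) R) : Matrix (Fin 2) (Fin 2) R) 0 0)) =
      -(t * ((b : GL (Fin 2) R) : Matrix (Fin 2) (Fin 2) R) 0 1 * σ (t * ((b : GL (Fin 2) R) : Matrix (Fin 2) (Fin 2) R) 0 0)) := by
  have h := skew_yPrime hσ (1 : Rˣ) hb (y := 0) (by rw [map_zero, neg_zero]) t
  simpa only [inv_one, Units.val_one, map_one, one_mul, mul_zero, zero_add] using h

/-- the transported `y′ = y + λ_b(t)` is skew. [cite: Xiong2013, §7 Lemma 7.1] -/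
theorem add_skewShift_skew (hσ : ∀ x, σ (σ x) = x) {b : unitaryGroupOfForm σ ((StdForm.antidiagonal 2).over R)} (hb : ((b : GL (Fin 2) R) : Matrix (Fin 2) (Fin 2) R) 1 0 = 0)
    {y : R} (hy : σ y = -y) (t : R) :
    σ (y + t * ((b : GL (Fin 2) R) : Matrix (Fin 2) (Fin 2) R) 0 1 * σ (t * ((b : GL (Fin 2) R) : Matrix (Fin 2) (Fin 2) R) 0 0)) =
      -(y + t * ((b : GL (Fin 2) R) : Matrix (Fin 2) (Fin 2) R) 0 1 * σ (t * ((b : GL (Fin 2) R) : Matrix (Fin 2) (Fin 2) R) 0 0)) := by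
  rw [map_add, hy, skewShift_skew hσ hb t, neg_add]

/-- **THE LETTER IDENTITY** for upper-triangular `b ∈ U(J₂)` and any `g`:
`ξ · n_Q(y,0,t) · m_Q(1, b g) = (ξ · m_Q(1,b) · ξ⁻¹) · ((ξ · u₊(t b₀₁) · ξ⁻¹) · (ξ · n_Q(y + λ_b(t), 0, t b₀₀) · m_Q(1,g)))`
(★ `klingenLevi_one_mul`, ★ `nKlingen_mul_klingenLevi_of_upper` at `a = 1`, ★ `nKlingen_eq_uPlus_mul`). [cite: MoeglinWaldspurger1995, II.1.7] [cite: Xiong2013, §7 Lemma 7.1] -/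
theorem weylXi_nKlingen_klingenLevi_of_upper (hσ : ∀ x, σ (σ x) = x) {b : unitaryGroupOfForm σ ((StdForm.antidiagonal 2).over R)}
    (hb : ((b : GL (Fin 2) R) : Matrix (Fin 2) (Fin 2) R) 1 0 = 0) (g : unitaryGroupOfForm σ ((StdForm.antidiagonal 2).over R))
    (y : R) (hy : σ y = -y) (t : R) :
    weylXi R σ * nKlingen R σ hσ y hy 0 t * klingenLevi R σ hσ 1 (b * g) =
      (weylXi R σ * klingenLevi R σ hσ 1 b * (weylXi R σ)⁻¹) *
        ((weylXi R σ * uPlus R σ hσ (t * ((b : GL (Fin 2) R) : Matrix (Fin 2) (Fin 2) R) 0 1) * (weylXi R σ)⁻¹) *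
          (weylXi R σ * nKlingen R σ hσ (y + t * ((b : GL (Fin 2) R) : Matrix (Fin 2) (Fin 2) R) 0 1 * σ (t * ((b : GL (Fin 2) R) : Matrix (Fin 2) (Fin 2) R) 0 0))
            (add_skewShift_skew hσ hb hy t) 0 (t * ((b : GL (Fin 2) R) : Matrix (Fin 2) (Fin 2) R) 0 0) * klingenLevi R σ hσ 1 g)) := by
  have h1 := nKlingen_mul_klingenLevi_of_upper hσ (1 : Rˣ) hb y hy t
  have h2 : nKlingen R σ hσ
        (((1⁻¹ : Rˣ) : R) * σ ((1⁻¹ : Rˣ) : R) * y +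
          ((1⁻¹ : Rˣ) : R) * t * ((b : GL (Fin 2) R) : Matrix (Fin 2) (Fin 2) R) 0 1 * σ (((1⁻¹ : Rˣ) : R) * t * ((b : GL (Fin 2) R) : Matrix (Fin 2) (Fin 2) R) 0 0))
        (skew_yPrime hσ 1 hb hy t)
        (((1⁻¹ : Rˣ) : R) * t * ((b : GL (Fin 2) R) : Matrix (Fin 2) (Fin 2) R) 0 1)
        (((1⁻¹ : Rˣ) : R) * t * ((b : GL (Fin 2) R) : Matrix (Fin 2) (Fin 2) R) 0 0) =
      uPlus R σ hσ (t * ((b : GL (Fin 2) R) : Matrix (Fin 2) (Fin 2) R) 0 1) *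
        nKlingen R σ hσ (y + t * ((b : GL (Fin 2) R) : Matrix (Fin 2) (Fin 2) R) 0 1 * σ (t * ((b : GL (Fin 2) R) : Matrix (Fin 2) (Fin 2) R) 0 0))
          (add_skewShift_skew hσ hb hy t) 0 (t * ((b : GL (Fin 2) R) : Matrix (Fin 2) (Fin 2) R) 0 0) := by
    rw [← nKlingen_eq_uPlus_mul hσ]
    exact nKlingen_congr hσ (by simp only [inv_one, Units.val_one, map_one, one_mul]) (by simp only [inv_one, Units.val_one, one_mul])
      (by simp only [inv_one, Units.val_one, one_mul])
  rw [klingenLevi_one_mul hσ, ← mul_assoc (weylXi R σ * nKlingen R σ hσ y hy 0 t), mul_assoc (weylXi R σ), h1, h2]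
  simp only [mul_assoc, inv_mul_cancel_left]

end Generic

/-! ## §2 The payer at a finite place `v` of `L⁺` -/

section Local

variable (L : Type) [Field L] [NumberField L] [IsCMField L] (v : HeightOneSpectrum (𝓞 (Fp L)))

set_option synthInstance.maxHeartbeats 200000 in -- instance paths on `LocalRing L v = Π_w L_w` (as ★ B `evalPlace_finPart_klingenLevi_one`)
set_option maxHeartbeats 800000 in -- MEASURED (fails at 400000, passes at 800000): `whnf` of the `↥(skewLoc v) × LocalRing L v` ∕ `jLoc` letter tower in the statements of `key`∕`e2`; plain `rw`∕`exact`, no search tactics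
/-- **THE LOCAL BOREL LAW OF `J_v` (FILE C's `hlaw`, hypothesis-first).**  Statement and proof in the header. [cite: MoeglinWaldspurger1995, II.1.7] [cite: Casselman1980, §3] [cite: BorelJacquet1979, §4.1] -/
theorem innerSectionLoc_upper_mul
    [MeasurableSpace ↥(skewLoc L v)] [BorelSpace ↥(skewLoc L v)] [MeasurableSpace (LocalRing L v)] [BorelSpace (LocalRing L v)]
    (νY : Measure ↥(skewLoc L v)) (νT : Measure (LocalRing L v)) [SFinite νY] [SFinite νT] [νY.IsAddLeftInvariant]
    (mT : (∀ w : UnitaryGroup.PlacesOver L v, (w.1.adicCompletion L)ˣ) → ℝ≥0∞)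
    (hνT : ∀ u : ∀ w : UnitaryGroup.PlacesOver L v, (w.1.adicCompletion L)ˣ,
      νT.map (fun t : LocalRing L v => t * fun w => (u w : w.1.adicCompletion L)) = mT u • νT)
    {N' : ℕ} {J' : Matrix (Fin N') (Fin N') L}
    (Ψv : UnitaryGroup.localPi L (IsCMField.complexConj L) 4 ((StdForm.antidiagonal 4).over L) v →* UnitaryGroup.localPi L (IsCMField.complexConj L) N' J' v)
    (fv : UnitaryGroup.localPi L (IsCMField.complexConj L) N' J' v → ℂ) (xv : UnitaryGroup.localPi L (IsCMField.complexConj L) N' J' v)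
    (cΔ : UnitaryGroup.localPi L (IsCMField.complexConj L) 2 ((StdForm.antidiagonal 2).over L) v → ℂ)
    (hfP : ∀ b : UnitaryGroup.localPi L (IsCMField.complexConj L) 2 ((StdForm.antidiagonal 2).over L) v,
      (∀ w : UnitaryGroup.PlacesOver L v,
        (((b : UnitaryGroup.LocalGLPi L 2 v) w : GL (Fin 2) (w.1.adicCompletion L)) : Matrix (Fin 2) (Fin 2) (w.1.adicCompletion L)) 1 0 = 0) →
      ∀ h, fv (Ψv (jLoc L 4 v (weylXi (LocalRing L v) (conjLocal L (IsCMField.complexConj L) v) *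
          klingenLevi (LocalRing L v) (conjLocal L (IsCMField.complexConj L) v) (conjLocal_conjLocal_cm L v) 1 ((jLoc L 2 v).symm b) *
            (weylXi (LocalRing L v) (conjLocal L (IsCMField.complexConj L) v))⁻¹)) * h) = cΔ b * fv h)
    (hfU : ∀ (z : LocalRing L v) (h : UnitaryGroup.localPi L (IsCMField.complexConj L) N' J' v),
      fv (Ψv (jLoc L 4 v (weylXi (LocalRing L v) (conjLocal L (IsCMField.complexConj L) v) *
          uPlus (LocalRing L v) (conjLocal L (IsCMField.complexConj L) v) (conjLocal_conjLocal_cm L v) z *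
            (weylXi (LocalRing L v) (conjLocal L (IsCMField.complexConj L) v))⁻¹)) * h) = fv h)
    (b g : UnitaryGroup.localPi L (IsCMField.complexConj L) 2 ((StdForm.antidiagonal 2).over L) v)
    (hb : ∀ w : UnitaryGroup.PlacesOver L v,
      (((b : UnitaryGroup.LocalGLPi L 2 v) w : GL (Fin 2) (w.1.adicCompletion L)) : Matrix (Fin 2) (Fin 2) (w.1.adicCompletion L)) 1 0 = 0)
    (u : ∀ w : UnitaryGroup.PlacesOver L v, (w.1.adicCompletion L)ˣ)
    (hu : ∀ w : UnitaryGroup.PlacesOver L v, (u w : w.1.adicCompletion L) =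
      (((b : UnitaryGroup.LocalGLPi L 2 v) w : GL (Fin 2) (w.1.adicCompletion L)) : Matrix (Fin 2) (Fin 2) (w.1.adicCompletion L)) 0 0) :
    innerSectionLoc L v νY νT Ψv fv xv (b * g) = cΔ b * ((mT u).toReal : ℂ) * innerSectionLoc L v νY νT Ψv fv xv g := by
  -- the local letters behind `b`, `g`
  set b' := (jLoc L 2 v).symm b with hb'def
  set g' := (jLoc L 2 v).symm g with hg'def
  have hb' : ((b' : GL (Fin 2) (LocalRing L v)) : Matrix (Fin 2) (Fin 2) (LocalRing L v)) 1 0 = 0 :=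
    funext fun w => (coe_jLoc_symm_apply L 2 v b w 1 0).trans (hb w)
  have hu' : ((b' : GL (Fin 2) (LocalRing L v)) : Matrix (Fin 2) (Fin 2) (LocalRing L v)) 0 0 = fun w => (u w : w.1.adicCompletion L) :=
    funext fun w => (coe_jLoc_symm_apply L 2 v b w 0 0).trans (hu w).symm
  have hσ := conjLocal_conjLocal_cm L v
  -- point-set structure on `L_v = Π_{w∣v} L_w` and `Y_v`
  haveI : ∀ w : HeightOneSpectrum (𝓞 L), SecondCountableTopology (w.adicCompletion L) := fun w => secondCountableTopology_adicCompletion L w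
  haveI : SecondCountableTopology ↥(skewLoc L v) := TopologicalSpace.Subtype.secondCountableTopology _
  -- the unit `U = (u_w)_w ∈ L_v` and the shear `λ_b`
  set U : LocalRing L v := fun w => (u w : w.1.adicCompletion L) with hUdef
  let Uinv : LocalRing L v := fun w => ((u w)⁻¹ : (w.1.adicCompletion L)ˣ)
  have hUU : U * Uinv = 1 := funext fun w => (u w).mul_inv
  have hUU' : Uinv * U = 1 := funext fun w => (u w).inv_mul
  let lam : LocalRing L v → ↥(skewLoc L v) := fun t =>
    ⟨t * ((b' : GL (Fin 2) (LocalRing L v)) : Matrix (Fin 2) (Fin 2) (LocalRing L v)) 0 1 *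
        conjLocal L (IsCMField.complexConj L) v (t * ((b' : GL (Fin 2) (LocalRing L v)) : Matrix (Fin 2) (Fin 2) (LocalRing L v)) 0 0),
      skewShift_skew hσ hb' t⟩
  have hlam_cont : Continuous lam := by
    refine Continuous.subtype_mk ?_ _
    exact (continuous_id.mul continuous_const).mul ((continuous_conjLocal L (IsCMField.complexConj L) v).comp (continuous_id.mul continuous_const))
  -- Step 1: the integrand of `J_v(b g)` at `q` is `cΔ b ·` the integrand of `J_v(g)` at `(λ_b(t) + y, t·U)`
  have key : ∀ q : ↥(skewLoc L v) × LocalRing L v,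
      fv (Ψv (weylXiLoc L v * nKlingenLoc L v (q.1 : LocalRing L v) q.1.2 0 q.2 * klingenLeviLoc L v 1 (b * g)) * xv) =
        cΔ b * fv (Ψv (weylXiLoc L v * nKlingenLoc L v ((lam q.2 + q.1 : ↥(skewLoc L v)) : LocalRing L v) ((mem_skewLoc_iff L v _).1 (lam q.2 + q.1).2) 0 (q.2 * U) *
          klingenLeviLoc L v 1 g) * xv) := by
    intro q
    have e1 : weylXiLoc L v * nKlingenLoc L v (q.1 : LocalRing L v) q.1.2 0 q.2 * klingenLeviLoc L v 1 (b * g) =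
        jLoc L 4 v (weylXi (LocalRing L v) (conjLocal L (IsCMField.complexConj L) v) *
          nKlingen (LocalRing L v) (conjLocal L (IsCMField.complexConj L) v) hσ (q.1 : LocalRing L v) q.1.2 0 q.2 *
            klingenLevi (LocalRing L v) (conjLocal L (IsCMField.complexConj L) v) hσ 1 (b' * g')) := by
      rw [map_mul, map_mul, hb'def, hg'def, ← map_mul]
      rfl
    have h1 : ((lam q.2 + q.1 : ↥(skewLoc L v)) : LocalRing L v) =
        (q.1 : LocalRing L v) + q.2 * ((b' : GL (Fin 2) (LocalRing L v)) : Matrix (Fin 2) (Fin 2) (LocalRing L v)) 0 1 *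
          conjLocal L (IsCMField.complexConj L) v (q.2 * ((b' : GL (Fin 2) (LocalRing L v)) : Matrix (Fin 2) (Fin 2) (LocalRing L v)) 0 0) :=
      add_comm _ _
    have h3 : q.2 * U = q.2 * ((b' : GL (Fin 2) (LocalRing L v)) : Matrix (Fin 2) (Fin 2) (LocalRing L v)) 0 0 := by rw [hu']
    have e2 : nKlingenLoc L v ((lam q.2 + q.1 : ↥(skewLoc L v)) : LocalRing L v) ((mem_skewLoc_iff L v _).1 (lam q.2 + q.1).2) 0 (q.2 * U) =
        jLoc L 4 v (nKlingen (LocalRing L v) (conjLocal L (IsCMField.complexConj L) v) hσ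
            ((q.1 : LocalRing L v) + q.2 * ((b' : GL (Fin 2) (LocalRing L v)) : Matrix (Fin 2) (Fin 2) (LocalRing L v)) 0 1 *
              conjLocal L (IsCMField.complexConj L) v (q.2 * ((b' : GL (Fin 2) (LocalRing L v)) : Matrix (Fin 2) (Fin 2) (LocalRing L v)) 0 0))
            (add_skewShift_skew hσ hb' q.1.2 q.2) 0 (q.2 * ((b' : GL (Fin 2) (LocalRing L v)) : Matrix (Fin 2) (Fin 2) (LocalRing L v)) 0 0)) :=
      congrArg (jLoc L 4 v) (nKlingen_congr hσ h1 rfl h3)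
    have e3 : klingenLeviLoc L v 1 g = jLoc L 4 v (klingenLevi (LocalRing L v) (conjLocal L (IsCMField.complexConj L) v) hσ 1 g') := by
      rw [hg'def]; rfl
    have split1 : ∀ A B C : unitaryGroupOfForm (conjLocal L (IsCMField.complexConj L) v) ((StdForm.antidiagonal 4).over (LocalRing L v)),
        Ψv (jLoc L 4 v (A * (B * C))) * xv = Ψv (jLoc L 4 v A) * (Ψv (jLoc L 4 v B) * (Ψv (jLoc L 4 v C) * xv)) := by
      intro A B C
      rw [map_mul, map_mul, map_mul, map_mul, mul_assoc, mul_assoc]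
    have split2 : ∀ A B C : unitaryGroupOfForm (conjLocal L (IsCMField.complexConj L) v) ((StdForm.antidiagonal 4).over (LocalRing L v)),
        jLoc L 4 v A * jLoc L 4 v B * jLoc L 4 v C = jLoc L 4 v (A * B * C) := by
      intro A B C
      rw [map_mul, map_mul]
    have hP : ∀ h, fv (Ψv (jLoc L 4 v (weylXi (LocalRing L v) (conjLocal L (IsCMField.complexConj L) v) *
          klingenLevi (LocalRing L v) (conjLocal L (IsCMField.complexConj L) v) hσ 1 b' *
            (weylXi (LocalRing L v) (conjLocal L (IsCMField.complexConj L) v))⁻¹)) * h) = cΔ b * fv h := by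
      intro h
      have hh := hfP b hb h
      rwa [← hb'def] at hh
    rw [e1, weylXi_nKlingen_klingenLevi_of_upper hσ hb' g' (q.1 : LocalRing L v) q.1.2 q.2, split1, hP, hfU, e2, e3]
    show cΔ b * fv (Ψv (jLoc L 4 v _) * xv) = cΔ b * fv (Ψv (jLoc L 4 v _ * jLoc L 4 v _ * jLoc L 4 v _) * xv)
    rw [split2]
  -- Step 2: the two substitutions
  let F : ↥(skewLoc L v) × LocalRing L v → ℂ := fun q =>
    fv (Ψv (weylXiLoc L v * nKlingenLoc L v (q.1 : LocalRing L v) q.1.2 0 q.2 * klingenLeviLoc L v 1 g) * xv)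
  have hF : ∀ q : ↥(skewLoc L v) × LocalRing L v,
      fv (Ψv (weylXiLoc L v * nKlingenLoc L v ((lam q.2 + q.1 : ↥(skewLoc L v)) : LocalRing L v) ((mem_skewLoc_iff L v _).1 (lam q.2 + q.1).2) 0 (q.2 * U) *
        klingenLeviLoc L v 1 g) * xv) = F (lam q.2 + q.1, q.2 * U) := fun q => rfl
  -- (a) the shear `(y, t) ↦ (λ_b(t) + y, t)` preserves `ν_Y ⊗ ν_T`
  let sh : (↥(skewLoc L v) × LocalRing L v) ≃ᵐ (↥(skewLoc L v) × LocalRing L v) :=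
    { toFun := fun q => (lam q.2 + q.1, q.2)
      invFun := fun q => (-lam q.2 + q.1, q.2)
      left_inv := fun q => by simp only [neg_add_cancel_left]
      right_inv := fun q => by simp only [add_neg_cancel_left]
      measurable_toFun := ((hlam_cont.measurable.comp measurable_snd).add measurable_fst).prodMk measurable_snd
      measurable_invFun := ((hlam_cont.measurable.comp measurable_snd).neg.add measurable_fst).prodMk measurable_snd }
  have hsh : MeasurePreserving sh (νY.prod νT) (νY.prod νT) := by
    have hmid : MeasurePreserving (fun p : LocalRing L v × ↥(skewLoc L v) => (p.1, lam p.1 + p.2)) (νT.prod νY) (νT.prod νY) :=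
      MeasurePreserving.skew_product (MeasurePreserving.id νT) ((hlam_cont.measurable.comp measurable_fst).add measurable_snd)
        (Eventually.of_forall fun t => map_add_left_eq_self νY (lam t))
    exact (measurePreserving_swap.comp (hmid.comp measurePreserving_swap))
  -- (b) the scaling `t ↦ t·U`
  let sc : (↥(skewLoc L v) × LocalRing L v) ≃ᵐ (↥(skewLoc L v) × LocalRing L v) :=
    { toFun := fun q => (q.1, q.2 * U)
      invFun := fun q => (q.1, q.2 * Uinv)
      left_inv := fun q => Prod.ext rfl (by show q.2 * U * Uinv = q.2; rw [mul_assoc, hUU, mul_one])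
      right_inv := fun q => Prod.ext rfl (by show q.2 * Uinv * U = q.2; rw [mul_assoc, hUU', mul_one])
      measurable_toFun := measurable_fst.prodMk ((measurable_mul_const U).comp measurable_snd)
      measurable_invFun := measurable_fst.prodMk ((measurable_mul_const Uinv).comp measurable_snd) }
  have hsc : Measure.map sc (νY.prod νT) = mT u • νY.prod νT := by
    have h1 : (⇑sc) = Prod.map id (fun t : LocalRing L v => t * U) := rfl
    rw [h1, ← Measure.map_prod_map νY νT measurable_id (measurable_mul_const U), Measure.map_id, hUdef, hνT u, Measure.prod_smul_right]
  -- assembling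
  rw [innerSectionLoc_def, innerSectionLoc_def]
  have hint : ∫ q, fv (Ψv (weylXiLoc L v * nKlingenLoc L v (q.1 : LocalRing L v) q.1.2 0 q.2 * klingenLeviLoc L v 1 (b * g)) * xv) ∂(νY.prod νT) =
      ∫ q, cΔ b * F (sc (sh q)) ∂(νY.prod νT) :=
    integral_congr_ae (Eventually.of_forall fun q => (key q).trans (congrArg (fun z => cΔ b * z) (hF q)))
  rw [hint, integral_const_mul, hsh.integral_comp' (fun q => F (sc q)), ← integral_map_equiv sc F, hsc, integral_smul_measure,
    Complex.real_smul, ← mul_assoc]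

end Local

end Summit.HodgeConjecture.HodgeConjecture.Cruxes.HLiu418.K2LiuKlingenInnerSectionLocalLaw

end
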